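import Literature.RingTheory.LocalCohomology.CechFiniteness
import Literature.RingTheory.LocalCohomology.CechBaseChange
import HarnessLib

/-!
# Base change for `H²` of the Čech complex

Topic `Literature/RingTheory/LocalCohomology`, sequel of `CechBaseChange.lean` and
`CechFiniteness.lean`. For an `R`-algebra `B`, a `B`-module `M` and `y : Fin s → R`, the base
change isomorphisms `Č^n(y; M) ≅ Č^n(ȳ; M)` (`cechObjBaseChange`) commute with the differentials,
hence induce an injective `R`-linear map `H²(y; M) → H²(ȳ; M)` (`h2BaseChange`,
`h2BaseChange_injective`); in particular `H²(y; M)` is a Noetherian `R`-module as soon as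
`H²(ȳ; M)` is (`isNoetherian_H2_of_baseChange`). This feeds the finiteness theorem
`Module.finite_H2_ideal` (stated over the ring `B ⊇ J`) into Čech computations over a ring
`S ↠ B` (`Literature/RingTheory/RegularLocalRing/GrothendieckSamuelHypersurface*`).

Everything is proved; no named facts.

## References

* [Grothendieck1968SGA2] A. Grothendieck, SGA 2, Exp. II and Exp. VIII Thm. 2.3 (arXiv:math/0511279).
* [Eisenbud2005] D. Eisenbud, *The Geometry of Syzygies*, GTM 229, Appendix 1, Thm. A1.3.
-/

noncomputable section

open CategoryTheory AlgebraicTopology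

universe u

namespace Literature.RingTheory.LocalCohomology

variable {R : Type u} [CommRing R] (B : Type u) [CommRing B] [Algebra R B] {s : ℕ}
  (y : Fin s → R) (M : Type u) [AddCommGroup M] [Module R M] [Module B M] [IsScalarTower R B M]

/-- Base change on cocycles `Z¹`. [folklore] -/
def z1BaseChange : Z1 (y := y) (M := M) →ₗ[R] (Z1 (y := yB B y) (M := M)).restrictScalars R :=
  ((cechObjBaseChange B y M 1).toLinearMap.comp (Z1 (y := y) (M := M)).subtype).codRestrict _ (by
    intro z
    change dC 1 (cechObjBaseChange B y M 1 (z : CechObj y M 1)) = 0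
    rw [dC_cechObjBaseChange, LinearMap.mem_ker.mp z.2, map_zero])

/-- **Base change on `H²`** (as an `R`-linear map into the `R`-restriction of `H²` over `B`).
[folklore] -/
def h2BaseChange : H2 (y := y) (M := M) →ₗ[R]
    ((Z1 (y := yB B y) (M := M)).restrictScalars R ⧸
      ((B1 (y := yB B y) (M := M)).restrictScalars R)) :=
  Submodule.mapQ _ _ (z1BaseChange B y M) (by
    intro z hz
    simp only [Submodule.mem_comap, Submodule.coe_subtype, LinearMap.mem_range] at hz ⊢
    obtain ⟨w, hw⟩ := hz
    refine ⟨cechObjBaseChange B y M 0 w, ?_⟩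
    rw [dC_cechObjBaseChange, hw]
    rfl)

/-- The base change map on `H²` is injective. [folklore] -/
theorem h2BaseChange_injective : Function.Injective (h2BaseChange B y M) := by
  rw [injective_iff_map_eq_zero]
  intro e he
  obtain ⟨⟨z, hz⟩, rfl⟩ := Submodule.Quotient.mk_surjective _ e
  have he' : ((z1BaseChange B y M ⟨z, hz⟩ : Z1 (y := yB B y) (M := M)) : CechObj (yB B y) M 1) ∈
      LinearMap.range (dC (y := yB B y) (M := M) 0) := by
    have : Submodule.mapQ _ _ (z1BaseChange B y M) _ (Submodule.Quotient.mk ⟨z, hz⟩) = 0 := he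
    rw [Submodule.mapQ_apply, Submodule.Quotient.mk_eq_zero] at this
    exact this
  obtain ⟨w, hw⟩ := he'
  obtain ⟨w', rfl⟩ := (cechObjBaseChange B y M 0).surjective w
  rw [dC_cechObjBaseChange] at hw
  have hzw : z = dC 0 w' := by
    apply (cechObjBaseChange B y M 1).injective
    exact hw.symm
  rw [Submodule.Quotient.mk_eq_zero]
  simp only [Submodule.mem_comap, Submodule.coe_subtype, LinearMap.mem_range]
  exact ⟨w', hzw.symm⟩

/-- **`H²` over `R` is Noetherian when `H²` over `B` is** (as an `R`-module). [folklore] -/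
theorem isNoetherian_H2_of_baseChange
    [IsNoetherian R ((Z1 (y := yB B y) (M := M)).restrictScalars R ⧸
      ((B1 (y := yB B y) (M := M)).restrictScalars R))] :
    IsNoetherian R (H2 (y := y) (M := M)) :=
  isNoetherian_of_injective (h2BaseChange B y M) (h2BaseChange_injective B y M)

end Literature.RingTheory.LocalCohomology

end
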